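import Summits.SmoothPoincare4.SmoothPoincare4.Theorems.ConvexBisectionAcyclicBisectionExistsPageTwistingTransverse
import Literature.Geometry.Symplectic.AttachingFramingProofs
import Literature.Geometry.Symplectic.AttachingCircleProofs
import Literature.Topology.FourManifolds.HandleAttachingMapsTransport
import HarnessLib

/-!
# The twisting loop of a framing of a page curve never vanishes
(wave 3, brick (M3b-geo), loop part, of stub `stub_modelsOnFibred_of_reach` = NF4
`Literature.Topology.FourManifolds.LefschetzBase.modelsOnFibred_of_reach`, line `modp-braid-orbits`
r11, crux `ConvexBisection.AcyclicBisectionExists`, item stmt-SmoothPoincare4-10508; registered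
sub-goal `helper_pageTwistingLoop_ne_zero`)

Sequel of `…PageTwistingTransverse.lean` (the pointwise statement `helper_twistPair_eq_zero_iff`:
for `V` tangent to the `rho`-level and `T ≠ 0` in the complex tangent line of the page,
`(⟪V, iT⟫, ⟪V, n⟫) = 0 ↔ V ∈ ℝ · T`).  Here the chart vectors of `Base g` are read in `ℝ⁴`:

* §4 **ambient vectors at boundary points.**  `ambient g x = d(incl)_x` (`LefschetzBasePages.lean`
  §6) is injective (`injective_ambient`: the inclusion `Base g ↪ ℝ⁴` is an immersion) and, at a
  point `x ∈ ∂ Base g`, satisfies `d rho (ambient g x v) = -v₀` (`fderiv_rho_ambient`): the preferred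
  chart of the regular sublevel set `Base g = {rho ≤ 1/4}` at a boundary point is a half-slice chart
  with `0`-th coordinate `1/4 − rho` (`RegularLevelSplitting.lean`), so the tangent hyperplane
  `{v₀ = 0}` of the boundary (`boundaryTangentSpace`) goes to `ker d rho`.  The ambient velocity of
  a loop is the ambient image of its chart velocity (`hasDerivAt_ambCurve`:
  `(ambCurve g K)' = ambient (knotVelocity K)`, chain rule).
* §5 **the loop form** `helper_pageTwistingLoop_ne_zero`: for a smooth embedding `K : 𝕊¹ → Base g`
  with values in one page `page g c` (`‖c‖ = 1`) and a framing `ν` of `K` in `∂ Base g`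
  (`IsKnotFraming K ν`, `SteinBoundaryContact.lean`), `pageTwistingLoop g K ν t ≠ 0` for all `t`
  (the velocity is non-zero and `ℂ`-tangent to the page since `w ∘ K ≡ c/2`; the framing vector is
  tangent to `{rho = 1/4}` and not a real multiple of the velocity; §4 + the pointwise statement).
* §6 **handle form and transport.**  For a `2`-handle attaching map `h̄` on `Base g` whose
  attaching circle lies in a page, the twisting loop of its handle framing never vanishes
  (`isKnotFraming_attachingFraming`, `isSmoothEmbedding_attachingCircle`), also after transport by
  a diffeomorphism keeping the circle in a page (`attachingCircle_transport`,
  `attachingFraming_transport`); hence **along an ambient isotopy `R` of `Base g` that keeps the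
  attaching circle inside pages at every stage, the page twisting of the transported attaching map
  `h̄.transport (R 1)` equals that of `h̄`** (`pageTwisting_transport_eq_of_fibred` =
  `pageTwisting_comp_ambientIsotopy` of `…PageInvarianceTwisting.lean` with its non-vanishing
  hypothesis discharged).

Everything is proved; no named facts, no `sorry`.  References: J. B. Etnyre, T. Fuller,
*Realizing 4-manifolds as achiral Lefschetz fibrations*, IMRN 2006, §2 [EtnyreFuller2006];
R. E. Gompf, A. I. Stipsicz, *4-Manifolds and Kirby Calculus* (1999), §8.2.
-/

noncomputable section

set_option linter.dupNamespace false

open scoped Manifold ContDiff Topology ComplexConjugate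
open Set Function Metric
open Literature.Topology.FourManifolds Literature.Topology.FourManifolds.LefschetzBase
open Literature.Geometry.Symplectic

namespace Summit.SmoothPoincare4.SmoothPoincare4.Theorems.AcyclicBisectionExists.ModpBraidOrbits

variable {g : ℕ}

/-! ## §4 Ambient vectors at boundary points of the base -/

/-- **The differential of the inclusion at a boundary point straightens `rho`**: for `x ∈ ∂ Base g`
and a chart vector `v ∈ T_x Base g = ℝ⁴`, `d rho (ambient g x v) = -v₀` — the preferred chart at a
boundary point is a half-slice chart whose `0`-th coordinate is `1/4 − rho`. In particular
`ambient g x` maps the tangent hyperplane `{v₀ = 0}` of the boundary onto `ker d rho`. [folklore] -/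
theorem fderiv_rho_ambient (x : Base g) (hx : rho g x.1 = 1 / 4) (v : EuclideanSpace ℝ (Fin 4)) :
    fderiv ℝ (rho g) x.1 (ambient g x v) = -(v 0) := by
  set h := isRegularLevel_rho g with hh
  set Φ := RegularSublevel.halfSliceAtlas h with hΦ
  set D := Φ.datum x with hD
  have hps : x.1 ∈ D.Θ.source := Φ.mem_source x
  have hz₀t : D.Θ x.1 ∈ D.Θ.target := D.Θ.map_source hps
  have hdiff : Differentiable ℝ (rho g) := (contDiff_rho g).differentiable (by simp)
  have hsd : DifferentiableAt ℝ D.Θ.symm (D.Θ x.1) :=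
    (((contMDiffOn_iff_contDiffOn.1 D.contMDiffOn_symm) _ hz₀t).contDiffAt
      (D.Θ.open_target.mem_nhds hz₀t)).differentiableAt (by simp)
  -- (a) the manifold derivative of the inclusion is the derivative of `Θ.symm`
  have hmf : mfderiv (𝓡∂ 4) (𝓡 4) (RegularSublevel.incl h) x = fderiv ℝ D.Θ.symm (D.Θ x.1) := by
    have hmd : MDifferentiableAt (𝓡∂ 4) (𝓡 4) (RegularSublevel.incl h) x :=
      (RegularSublevel.contMDiff_incl h).mdifferentiableAt (by simp)
    rw [hmd.mfderiv]
    have hself : extChartAt (𝓡∂ 4) x x = D.Θ x.1 := Φ.extChartAt_self_apply x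
    rw [hself]
    have hev : writtenInExtChartAt (𝓡∂ 4) (𝓡 4) x (RegularSublevel.incl h)
        =ᶠ[𝓝[range (𝓡∂ 4)] (D.Θ x.1)] D.Θ.symm := by
      have hmem : D.Θ.target ∈ 𝓝[range (𝓡∂ 4)] (D.Θ x.1) :=
        mem_nhdsWithin_of_mem_nhds (D.Θ.open_target.mem_nhds hz₀t)
      filter_upwards [hmem, self_mem_nhdsWithin] with z hz hzr
      rw [range_modelWithCornersEuclideanHalfSpace] at hzr
      have hz0 : 0 ≤ z 0 := hzr
      show extChartAt (𝓡 4) (RegularSublevel.incl h x)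
        (RegularSublevel.incl h ((extChartAt (𝓡∂ 4) x).symm z)) = D.Θ.symm z
      rw [extChartAt_self_apply, modelWithCornersSelf_coe, id_eq]
      exact D.coe_extend_chart_symm_of_mem (p := x) hz0 hz
    have hz₀r : D.Θ x.1 ∈ range (𝓡∂ 4) := mem_range_modelHalf (D.apply_zero_nonneg hps x.2)
    rw [hev.fderivWithin_eq_of_mem hz₀r]
    exact hsd.hasFDerivAt.hasFDerivWithinAt.fderivWithin ((𝓡∂ 4).uniqueDiffOn _ hz₀r)
  -- (b) in the chart, `rho = 1/4 - z₀`
  have hrho : ∀ z ∈ D.Θ.target, rho g (D.Θ.symm z) = 1 / 4 - z 0 := by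
    intro z hz
    have hq : D.Θ.symm z ∈ D.Θ.source := D.Θ.map_target hz
    have key : D.Θ (D.Θ.symm z) 0 = 1 / 4 - rho g (D.Θ.symm z) :=
      sublevelAtlas'_datum_apply_zero_of_eq h.contMDiff (1 / 4)
        (fun _ hp => h.not_isMCriticalPt hp) x hx hq
    rw [D.Θ.right_inv hz] at key
    linarith
  -- (c) chain rule against the affine function `z ↦ 1/4 - z 0`
  have hcomp : HasFDerivAt (fun z => rho g (D.Θ.symm z))
      ((fderiv ℝ (rho g) x.1).comp (fderiv ℝ D.Θ.symm (D.Θ x.1))) (D.Θ x.1) := by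
    have h1 : HasFDerivAt (rho g) (fderiv ℝ (rho g) x.1) (D.Θ.symm (D.Θ x.1)) := by
      rw [D.Θ.left_inv hps]
      exact (hdiff _).hasFDerivAt
    exact h1.comp _ hsd.hasFDerivAt
  have hlin : HasFDerivAt (fun z : EuclideanSpace ℝ (Fin 4) => (1 / 4 : ℝ) - z 0)
      (-(EuclideanSpace.proj (0 : Fin 4) : EuclideanSpace ℝ (Fin 4) →L[ℝ] ℝ)) (D.Θ x.1) := by
    have := ((EuclideanSpace.proj (0 : Fin 4) : EuclideanSpace ℝ (Fin 4) →L[ℝ] ℝ).hasFDerivAt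
      (x := D.Θ x.1)).const_sub (1 / 4 : ℝ)
    exact this
  have heq : (fun z => rho g (D.Θ.symm z)) =ᶠ[𝓝 (D.Θ x.1)]
      fun z : EuclideanSpace ℝ (Fin 4) => (1 / 4 : ℝ) - z 0 := by
    filter_upwards [D.Θ.open_target.mem_nhds hz₀t] with z hz
    exact hrho z hz
  have huniq := (hcomp.congr_of_eventuallyEq heq.symm).unique hlin
  have := congrArg (fun L : EuclideanSpace ℝ (Fin 4) →L[ℝ] ℝ => L v) huniq
  simp only [ContinuousLinearMap.comp_apply, FunLike.coe_neg, Pi.neg_apply] at this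
  rw [ambient, hmf]
  exact this

/-- **`ambient g x` is injective** (the inclusion `Base g ↪ ℝ⁴` is a smooth embedding, hence an
immersion, and immersions have injective differential). [folklore] -/
theorem injective_ambient (x : Base g) : Injective (ambient g x) := by
  obtain ⟨F, _, _, hF⟩ := (RegularSublevel.isSmoothEmbedding_incl (isRegularLevel_rho g)).isImmersion
  exact Manifold.IsImmersionAtOfComplement.mfderiv_injective (hF x) (by simp)

/-- `ambient g x` is linear: it commutes with real scalars. [folklore] -/
theorem ambient_smul (x : Base g) (a : ℝ) (v : EuclideanSpace ℝ (Fin 4)) :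
    ambient g x (a • v) = a • ambient g x v :=
  (mfderiv (𝓡∂ 4) (𝓡 4) (RegularSublevel.incl (isRegularLevel_rho g)) x).map_smul a v

/-- **The ambient velocity is the ambient image of the chart velocity**: for `K : 𝕊¹ → Base g`
differentiable at `e^{2πit}`, `ambCurve g K = incl ∘ K ∘ circlePt` has derivative
`ambient g (K (e^{2πit})) (knotVelocity K t)` at `t` (chain rule). [folklore] -/
theorem hasDerivAt_ambCurve {K : sphere (0 : EuclideanSpace ℝ (Fin 2)) 1 → Base g} {t : ℝ}
    (hK : MDifferentiableAt (𝓡 1) (𝓡∂ 4) K (circlePt t)) :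
    HasDerivAt (ambCurve g K) (ambient g (K (circlePt t)) (knotVelocity K t)) t := by
  have h1 : MDifferentiableAt 𝓘(ℝ, ℝ) (𝓡∂ 4) (K ∘ circlePt) t :=
    hK.comp t (contMDiff_circlePt.mdifferentiableAt (by simp))
  have h2 : MDifferentiableAt (𝓡∂ 4) (𝓡 4) (RegularSublevel.incl (isRegularLevel_rho g))
      (K (circlePt t)) :=
    (RegularSublevel.contMDiff_incl _).mdifferentiableAt (by simp)
  have hd : DifferentiableAt ℝ (ambCurve g K) t := mdifferentiableAt_iff_differentiableAt.1 (h2.comp t h1)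
  have he : deriv (ambCurve g K) t = ambient g (K (circlePt t)) (knotVelocity K t) := by
    rw [← fderiv_apply_one_eq_deriv, ← mfderiv_eq_fderiv,
      show ambCurve g K = RegularSublevel.incl (isRegularLevel_rho g) ∘ (K ∘ circlePt) from rfl,
      mfderiv_comp t h2 h1]
    rfl
  rw [← he]
  exact hd.hasDerivAt

/-- The ambient velocity of a differentiable loop, as a `deriv`. [folklore] -/
theorem deriv_ambCurve {K : sphere (0 : EuclideanSpace ℝ (Fin 2)) 1 → Base g} {t : ℝ}
    (hK : MDifferentiableAt (𝓡 1) (𝓡∂ 4) K (circlePt t)) :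
    deriv (ambCurve g K) t = ambient g (K (circlePt t)) (knotVelocity K t) :=
  (hasDerivAt_ambCurve hK).deriv

/-! ## §5 The twisting loop of a framing of a page curve never vanishes -/

/-- **A loop in a page has ambient velocity in the complex tangent line `ker dΦ` of the page**:
`w ∘ ambCurve g K ≡ c/2` is constant, so `dΦ(K') = dw(K') = 0`. [folklore] -/
theorem dPhi_velocity_eq_zero_of_page {K : sphere (0 : EuclideanSpace ℝ (Fin 2)) 1 → Base g}
    {c : ℂ} (hpage : ∀ θ, K θ ∈ page g c) {t : ℝ} {T : EuclideanSpace ℝ (Fin 4)}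
    (hKd : HasDerivAt (ambCurve g K) T t) :
    dPhiX g (ambCurve g K t) * cx T + dPhiY (ambCurve g K t) * cy T = 0 := by
  have h1 := hasDerivAt_w_comp (g := g) hKd
  have h2 : HasDerivAt (fun s => w g (ambCurve g K s)) 0 t := by
    have : (fun s => w g (ambCurve g K s)) = fun _ => c / 2 := funext fun s => (hpage (circlePt s)).2
    rw [this]
    exact hasDerivAt_const _ _
  exact h1.unique h2

/-- **The twisting pair of an ambient framing vector, pointwise form.**  At the parameter `t` of a
loop `K` in `Base g` let `q = K(e^{2πit}) ∈ ℝ⁴` lie in the flat region off the central page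
(`‖x(q)‖² < 4`, `w(q) ≠ 0`), let the ambient velocity `T = (ambCurve g K)'(t)` be non-zero and
`ℂ`-tangent to the page (`dΦ_q(T) = 0`), and let the ambient framing vector
`V = ambient g (K _) (ν _)` be tangent to the level sets of `rho` (`d rho_q(V) = 0`).  Then the
twisting loop vanishes at `t` iff `V` is a real multiple of `T`. [cite: EtnyreFuller2006, §2] -/
theorem pageTwistingLoop_eq_zero_iff {K : sphere (0 : EuclideanSpace ℝ (Fin 2)) 1 → Base g}
    {ν : sphere (0 : EuclideanSpace ℝ (Fin 2)) 1 → EuclideanSpace ℝ (Fin 4)} {t : ℝ}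
    (hflat : ‖cx (ambCurve g K t)‖ ^ 2 < 4) (hw : w g (ambCurve g K t) ≠ 0)
    (hT : deriv (ambCurve g K) t ≠ 0)
    (hTL : dPhiX g (ambCurve g K t) * cx (deriv (ambCurve g K) t) +
      dPhiY (ambCurve g K t) * cy (deriv (ambCurve g K) t) = 0)
    (hV : fderiv ℝ (rho g) (ambCurve g K t) (ambient g (K (circlePt t)) (ν (circlePt t))) = 0) :
    pageTwistingLoop g K ν t = 0 ↔
      ∃ a : ℝ, ambient g (K (circlePt t)) (ν (circlePt t)) = a • deriv (ambCurve g K) t := by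
  have hq : ambCurve g K t ≠ 0 := coe_ne_zero (K (circlePt t))
  have hV' : (conj (w g (ambCurve g K t)) * (dPhiX g (ambCurve g K t) *
      cx (ambient g (K (circlePt t)) (ν (circlePt t))) + dPhiY (ambCurve g K t) *
      cy (ambient g (K (circlePt t)) (ν (circlePt t))))).re = 0 := by
    rw [fderiv_rho_apply_of_flat hflat] at hV
    linarith
  rw [← helper_twistPair_eq_zero_iff g _ _ _ hq hw hT hTL hV', pageTwistingLoop, Complex.ext_iff]
  rfl

/-- **Sub-goal `helper_pageTwistingLoop_ne_zero` of stub `stub_modelsOnFibred_of_reach`** (NF4,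
wave 3, brick (M3b-geo)): **the twisting loop of a framing of a smoothly embedded page curve never
vanishes.**  For a smooth embedding `K : 𝕊¹ → Base g` with values in the page `page g c`
(`‖c‖ = 1`) and a framing `ν` of `K` in `∂ Base g` (`IsKnotFraming`: tangent to the boundary,
nowhere tangent to `K`, in the charts of `Base g`), `pageTwistingLoop g K ν t ≠ 0` for every `t`:
read in `ℝ⁴` through the differential of the inclusion (injective, straightening `rho`), the
framing vector is tangent to `{rho = 1/4}` and is not a real multiple of the (non-zero) velocity,
which is `ℂ`-tangent to the page; conclude by `helper_twistPair_eq_zero_iff`.  This is the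
non-vanishing hypothesis of `pageTwisting_comp_ambientIsotopy` /
`helper_pageTwisting_eq_of_nonvanishing_family` for fibred families. [cite: EtnyreFuller2006, §2] -/
theorem helper_pageTwistingLoop_ne_zero : ∀ (g : ℕ) (c : ℂ)
    (K : Metric.sphere (0 : EuclideanSpace ℝ (Fin 2)) 1 →
      Literature.Topology.FourManifolds.LefschetzBase.Base g)
    (ν : Metric.sphere (0 : EuclideanSpace ℝ (Fin 2)) 1 → EuclideanSpace ℝ (Fin 4)) (t : ℝ),
    ‖c‖ = 1 → Manifold.IsSmoothEmbedding (𝓡 1) (𝓡∂ 4) ∞ K →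
    (∀ θ, K θ ∈ Literature.Topology.FourManifolds.LefschetzBase.page g c) →
    Literature.Geometry.Symplectic.IsKnotFraming K ν →
    Literature.Topology.FourManifolds.LefschetzBase.pageTwistingLoop g K ν t ≠ 0 := by
  intro g c K ν t hc hK hpage hν
  have hKd : MDifferentiableAt (𝓡 1) (𝓡∂ 4) K (circlePt t) :=
    hK.contMDiff.mdifferentiableAt (by simp)
  have hder := hasDerivAt_ambCurve (g := g) hKd
  have hderiv : deriv (ambCurve g K) t = ambient g (K (circlePt t)) (knotVelocity K t) := hder.deriv
  obtain ⟨hflat, hwc⟩ := hpage (circlePt t)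
  have hw : w g (ambCurve g K t) ≠ 0 := by
    intro h0
    have : c = 0 := by
      have e : w g (K (circlePt t)).1 = c / 2 := hwc
      rw [show w g (K (circlePt t)).1 = w g (ambCurve g K t) from rfl, h0] at e
      linear_combination (-2) * e  -- hmm
    rw [this, norm_zero] at hc
    exact zero_ne_one hc
  have hT : deriv (ambCurve g K) t ≠ 0 := by
    rw [hderiv]
    intro h0
    exact knotVelocity_ne_zero hK t (injective_ambient _ (h0.trans (map_zero _).symm))
  have hTL := dPhi_velocity_eq_zero_of_page hpage hder.differentiableAt.hasDerivAt
  have hbdry : rho g (ambCurve g K t) = 1 / 4 := rho_eq_of_mem_page g hc (hpage (circlePt t))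
  have hV : fderiv ℝ (rho g) (ambCurve g K t) (ambient g (K (circlePt t)) (ν (circlePt t))) = 0 := by
    rw [show ambCurve g K t = (K (circlePt t)).1 from rfl, fderiv_rho_ambient _ hbdry,
      (mem_boundaryTangentSpace_iff _).1 (hν.mem_boundaryTangentSpace _), neg_zero]
  rw [Ne, pageTwistingLoop_eq_zero_iff hflat hw hT hTL hV, hderiv]
  rintro ⟨a, ha⟩
  refine hν.not_mem_span t (Submodule.mem_span_singleton.2 ⟨a, injective_ambient (K (circlePt t)) ?_⟩)
  rw [ambient_smul, ← ha]

/-- **The twisting loop of a framing of a smoothly embedded page curve never vanishes** (dot-free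
form of `helper_pageTwistingLoop_ne_zero`). [cite: EtnyreFuller2006, §2] -/
theorem pageTwistingLoop_ne_zero_of_isKnotFraming
    {K : sphere (0 : EuclideanSpace ℝ (Fin 2)) 1 → Base g}
    {ν : sphere (0 : EuclideanSpace ℝ (Fin 2)) 1 → EuclideanSpace ℝ (Fin 4)} {c : ℂ} (hc : ‖c‖ = 1)
    (hK : Manifold.IsSmoothEmbedding (𝓡 1) (𝓡∂ 4) ∞ K) (hpage : ∀ θ, K θ ∈ page g c)
    (hν : IsKnotFraming K ν) (t : ℝ) : pageTwistingLoop g K ν t ≠ 0 :=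
  helper_pageTwistingLoop_ne_zero g c K ν t hc hK hpage hν

/-! ## §6 Handle form: attaching circles in pages and transport along fibred isotopies -/

/-- **The twisting loop of the handle framing of a `2`-handle attached along a page curve never
vanishes**: the attaching circle of `h̄` is a smooth embedding (`isSmoothEmbedding_attachingCircle`)
and its handle framing is a framing in `∂ Base g` (`isKnotFraming_attachingFraming`).
[cite: EtnyreFuller2006, §2] -/
theorem pageTwistingLoop_attachingFraming_ne_zero (h : HandleAttachingMap 3 2 (Base g)) {c : ℂ}
    (hc : ‖c‖ = 1) (hpage : ∀ θ, h.attachingCircle θ ∈ page g c) (t : ℝ) :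
    pageTwistingLoop g h.attachingCircle h.attachingFraming t ≠ 0 :=
  pageTwistingLoop_ne_zero_of_isKnotFraming hc (isSmoothEmbedding_attachingCircle h) hpage
    (isKnotFraming_attachingFraming h) t

/-- **The same after transport by a diffeomorphism `G` of the base keeping the circle in a page**:
the moved framed loop `(G ∘ K, dG(ν))` is the attaching circle and handle framing of the
transported attaching map `h̄.transport G` (`attachingCircle_transport`,
`attachingFraming_transport`). [cite: EtnyreFuller2006, §2] -/
theorem pageTwistingLoop_transport_ne_zero (h : HandleAttachingMap 3 2 (Base g))
    (G : Base g ≃ₘ⟮𝓡∂ 4, 𝓡∂ 4⟯ Base g) {c : ℂ} (hc : ‖c‖ = 1)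
    (hpage : ∀ θ, G (h.attachingCircle θ) ∈ page g c) (t : ℝ) :
    pageTwistingLoop g (G ∘ h.attachingCircle)
      (fun θ => mfderiv (𝓡∂ 4) (𝓡∂ 4) G (h.attachingCircle θ) (h.attachingFraming θ)) t ≠ 0 := by
  have e2 : (h.transport G).attachingFraming =
      fun θ => mfderiv (𝓡∂ 4) (𝓡∂ 4) G (h.attachingCircle θ) (h.attachingFraming θ) :=
    funext (HandleAttachingMap.attachingFraming_transport h G)
  rw [← HandleAttachingMap.attachingCircle_transport h G, ← e2]
  exact pageTwistingLoop_attachingFraming_ne_zero (h.transport G) hc hpage t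

/-- **Transport of the page twisting along a fibred ambient isotopy of the base.**  If an ambient
isotopy `R` of `Base g` keeps the attaching circle of the `2`-handle attaching map `h̄` inside pages
at every stage `s ∈ [0, 1]` (in the page of direction `c s`, `‖c s‖ = 1`), then the transported
attaching map `h̄.transport (R 1)` — attaching circle `R 1 ∘ K`, handle framing `d(R 1)(ν)` — has
the page twisting of `h̄`: `pageTwisting_comp_ambientIsotopy` with its non-vanishing hypothesis
supplied by `pageTwistingLoop_transport_ne_zero` at every stage.  (This is what makes the letter
of a Lefschetz handle — page twisting `∓1` — survive the isotopies realising Hurwitz moves.)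
[cite: EtnyreFuller2006, §2] -/
theorem pageTwisting_transport_eq_of_fibred (R : AmbientIsotopy (𝓡∂ 4) (Base g))
    (h : HandleAttachingMap 3 2 (Base g)) (c : ℝ → ℂ) (hc : ∀ s ∈ Icc (0 : ℝ) 1, ‖c s‖ = 1)
    (hfib : ∀ s ∈ Icc (0 : ℝ) 1, ∀ θ, R.toFun s (h.attachingCircle θ) ∈ page g (c s)) :
    pageTwisting g (h.transport (R.toDiffeomorph 1)).attachingCircle
        (h.transport (R.toDiffeomorph 1)).attachingFraming =
      pageTwisting g h.attachingCircle h.attachingFraming := by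
  have e1 : (h.transport (R.toDiffeomorph 1)).attachingCircle = R.toFun 1 ∘ h.attachingCircle := rfl
  have e2 : (h.transport (R.toDiffeomorph 1)).attachingFraming = fun θ =>
      mfderiv (𝓡∂ 4) (𝓡∂ 4) (R.toFun 1) (h.attachingCircle θ) (h.attachingFraming θ) :=
    funext (HandleAttachingMap.attachingFraming_transport h _)
  rw [e1, e2]
  refine pageTwisting_comp_ambientIsotopy R
    ((isSmoothEmbedding_attachingCircle h).contMDiff.of_le (by simp))
    (isKnotFraming_attachingFraming h).continuous ?_
  intro s hs t _
  exact pageTwistingLoop_transport_ne_zero h (R.toDiffeomorph s) (hc s hs) (hfib s hs) t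

end Summit.SmoothPoincare4.SmoothPoincare4.Theorems.AcyclicBisectionExists.ModpBraidOrbits

end
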